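import Mathlib
import Literature.AlgebraicGeometry.Resolution.RegularLocalRingsProofs
import HarnessLib

/-!
# Glue for the consumers of the FULL-CHAIN ring contract v3′ (OPTION R)

OURS (res-inputs-p-8b g2; critic R119 (a)(b)). Small ring-theoretic lemmas the ring-side descent (`CompletedChainDescent`, Q4/R-5) needs when it
reads CONTRACT v3′ `false_of_fullChain_tau_one'`: from a point-step disjunct for a label `c` one READS which element generates `𝔪_n R_{n+1}`
(`map_maximalIdeal_eq_span_of_forall_mem`, `…_of_ratBlock`, `…_of_nonRatBlock`, `…_of_oppBlock`), two generators of a principal ideal of a domain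
differ by a unit (`Ideal.span_singleton_eq_span_singleton`), a regular local ring of dimension `3` has no `2`-generated maximal ideal
(`false_of_span_pair_eq_maximalIdeal_of_ringKrullDim`), and the «opposite vertex» disjunct of ANOTHER label sharing the chart generator is
excluded (`false_of_oppBlock_of_map_maximalIdeal_eq_span`). Pure commutative algebra; AI-written, AI review weaker than expert review; nothing here is
a published theorem or a summit statement. [cite: CossartPiltant2008, Lemma 4.3 (5); Prop. 4.4 (proof, p. 11)]
-/

noncomputable section

open IsLocalRing

namespace Literature.AlgebraicGeometry.Resolution

universe u

variable {S S' : Type u} [CommRing S] [CommRing S'] [IsLocalRing S]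

/-- In a chart where every generator of `𝔪 = (c 0, c 1, c 2)` becomes a multiple of `g` and `g ∈ 𝔪 S'`, the extended maximal ideal is
`𝔪 S' = (g)` (the local equation of the exceptional divisor in a chart of the blow-up). [cite: CossartPiltant2008, Lemma 4.3 (5)] -/
theorem map_maximalIdeal_eq_span_of_forall_mem (φ : S →+* S') {c : Fin 3 → S}
    (hgen : Ideal.span {c 0, c 1, c 2} = maximalIdeal S) {g : S'} (hg : g ∈ (maximalIdeal S).map φ)
    (h : ∀ i, φ (c i) ∈ Ideal.span {g}) : (maximalIdeal S).map φ = Ideal.span {g} := by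
  apply le_antisymm
  · rw [← hgen, Ideal.map_span, Ideal.span_le]
    rintro _ ⟨r, hr, rfl⟩
    simp only [Set.mem_insert_iff, Set.mem_singleton_iff] at hr
    rcases hr with rfl | rfl | rfl
    · exact h 0
    · exact h 1
    · exact h 2
  · rw [Ideal.span_le, Set.singleton_subset_iff]; exact hg

/-- `φ (c j) ∈ 𝔪.map φ` for a generator `c j` of `𝔪 = (c 0, c 1, c 2)`. [folklore] -/
private theorem map_mem_map_maximalIdeal_of_span_eq (φ : S →+* S') {c : Fin 3 → S}
    (hgen : Ideal.span {c 0, c 1, c 2} = maximalIdeal S) (j : Fin 3) : φ (c j) ∈ (maximalIdeal S).map φ := by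
  apply Ideal.mem_map_of_mem
  rw [← hgen]
  refine Ideal.subset_span ?_
  fin_cases j <;> simp

/-- **Reading the chart from the rational block** (contract v3′ `hpt_cases`, first disjunct): if `φ c₀ = φ c₁ · y′` and
`φ (c₂ − a c₁) = φ c₁ · w′` then `𝔪 S' = (φ c₁)`. [cite: CossartPiltant2008, Lemma 4.3 (5)] -/
theorem map_maximalIdeal_eq_span_of_ratBlock (φ : S →+* S') {c : Fin 3 → S}
    (hgen : Ideal.span {c 0, c 1, c 2} = maximalIdeal S) {a : S} {y' w' : S'}
    (h0 : φ (c 0) = φ (c 1) * y') (h2 : φ (c 2 - a * c 1) = φ (c 1) * w') :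
    (maximalIdeal S).map φ = Ideal.span {φ (c 1)} := by
  refine map_maximalIdeal_eq_span_of_forall_mem φ hgen (map_mem_map_maximalIdeal_of_span_eq φ hgen 1) (fun i => ?_)
  fin_cases i
  · simp only [Fin.zero_eta]
    rw [h0]; exact Ideal.mul_mem_right _ _ (Ideal.mem_span_singleton_self _)
  · exact Ideal.mem_span_singleton_self _
  · simp only [Fin.reduceFinMk]
    have e : φ (c 2) = φ (c 2 - a * c 1) + φ a * φ (c 1) := by rw [map_sub, map_mul]; ring
    rw [e, h2]
    exact Ideal.add_mem _ (Ideal.mul_mem_right _ _ (Ideal.mem_span_singleton_self _))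
      (Ideal.mul_mem_left _ _ (Ideal.mem_span_singleton_self _))

/-- **Reading the chart from the non-rational block** (second disjunct): `φ c₀ = φ c₁ · y′`, `φ c₂ = φ c₁ · t` ⇒ `𝔪 S' = (φ c₁)`.
[cite: CossartPiltant2008, Lemma 4.3 (5)] -/
theorem map_maximalIdeal_eq_span_of_nonRatBlock (φ : S →+* S') {c : Fin 3 → S}
    (hgen : Ideal.span {c 0, c 1, c 2} = maximalIdeal S) {y' t : S'}
    (h0 : φ (c 0) = φ (c 1) * y') (h2 : φ (c 2) = φ (c 1) * t) :
    (maximalIdeal S).map φ = Ideal.span {φ (c 1)} := by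
  refine map_maximalIdeal_eq_span_of_forall_mem φ hgen (map_mem_map_maximalIdeal_of_span_eq φ hgen 1) (fun i => ?_)
  fin_cases i
  · simp only [Fin.zero_eta]
    rw [h0]; exact Ideal.mul_mem_right _ _ (Ideal.mem_span_singleton_self _)
  · exact Ideal.mem_span_singleton_self _
  · simp only [Fin.reduceFinMk]
    rw [h2]; exact Ideal.mul_mem_right _ _ (Ideal.mem_span_singleton_self _)

/-- **Reading the chart from the opposite-vertex block** (third disjunct): `φ c₀ = φ c₂ · y′`, `φ c₁ = φ c₂ · v′` ⇒ `𝔪 S' = (φ c₂)`.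
[cite: CossartPiltant2008, Lemma 4.3 (5)] -/
theorem map_maximalIdeal_eq_span_of_oppBlock (φ : S →+* S') {c : Fin 3 → S}
    (hgen : Ideal.span {c 0, c 1, c 2} = maximalIdeal S) {y' v' : S'}
    (h0 : φ (c 0) = φ (c 2) * y') (h1 : φ (c 1) = φ (c 2) * v') :
    (maximalIdeal S).map φ = Ideal.span {φ (c 2)} := by
  refine map_maximalIdeal_eq_span_of_forall_mem φ hgen (map_mem_map_maximalIdeal_of_span_eq φ hgen 2) (fun i => ?_)
  fin_cases i
  · simp only [Fin.zero_eta]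
    rw [h0]; exact Ideal.mul_mem_right _ _ (Ideal.mem_span_singleton_self _)
  · simp only [Fin.mk_one]
    rw [h1]; exact Ideal.mul_mem_right _ _ (Ideal.mem_span_singleton_self _)
  · exact Ideal.mem_span_singleton_self _

/-- **A regular local ring of dimension `3` has no `2`-generated maximal ideal.** [cite: Matsumura1987, §14] -/
theorem false_of_span_pair_eq_maximalIdeal_of_ringKrullDim {T : Type u} [CommRing T] [IsRegularLocalRing T]
    (hdim : ringKrullDim T = 3) {a b : T} (h : Ideal.span {a, b} = maximalIdeal T) : False := by
  have hd : (maximalIdeal T).spanFinrank = 3 := by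
    have h' := (isRegularLocalRing_iff T).mp inferInstance
    rw [hdim] at h'
    exact_mod_cast h'
  have h1 : (Ideal.span {a, b}).spanFinrank ≤ ({a, b} : Set T).ncard :=
    Submodule.spanFinrank_span_le_ncard_of_finite (Set.toFinite _)
  have h2 : ({a, b} : Set T).ncard ≤ 2 := by
    refine (Set.ncard_insert_le a {b}).trans ?_
    rw [Set.ncard_singleton]
  have h3 : (Ideal.span {a, b}).spanFinrank = 3 := by rw [h]; exact hd
  omega

/-- **The opposite-vertex disjunct of ANOTHER label sharing the chart generator is excluded**: if `𝔪_S S' = (g)` while a block says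
`g = h · v′` with `(y′, v′, h)` a regular system of parameters of the `3`-dimensional regular local ring `S'`, contradiction (then `h ∈ (g) =
(h v′)` forces `h = 0`, and `𝔪' = (y′, v′)` would be `2`-generated). Used by the descent to instantiate the bricks' `∀`-label hypotheses from
contract v3′'s `hpt_cases`. [cite: CossartPiltant2008, Prop. 4.4 (proof, p. 11)] -/
theorem false_of_oppBlock_of_map_maximalIdeal_eq_span {T : Type u} [CommRing T] [IsRegularLocalRing T] (hdim' : ringKrullDim T = 3)
    {M : Ideal T} {g h y' v' : T} (hE : M = Ideal.span {g}) (hhM : h ∈ M) (h1 : g = h * v')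
    (hgen' : Ideal.span {y', v', h} = maximalIdeal T) : False := by
  haveI : IsDomain T := isDomain_of_isRegularLocalRing _
  have hv' : v' ∈ maximalIdeal T := hgen' ▸ Ideal.subset_span (by simp)
  rw [hE] at hhM
  obtain ⟨r, hr⟩ := Ideal.mem_span_singleton'.mp hhM
  rw [h1] at hr
  have hzero : h = 0 := by
    have hunit : IsUnit (1 - r * v') :=
      IsLocalRing.isUnit_one_sub_self_of_mem_nonunits _ ((IsLocalRing.mem_maximalIdeal _).mp (Ideal.mul_mem_left _ r hv'))
    have : h * (1 - r * v') = 0 := by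
      rw [mul_sub, mul_one, sub_eq_zero]
      calc h = r * (h * v') := hr.symm
        _ = h * (r * v') := by ring
    exact (hunit.mul_left_eq_zero).mp this
  rw [hzero, Ideal.span, Submodule.span_insert, Submodule.span_insert, Submodule.span_zero_singleton, sup_bot_eq,
    ← Submodule.span_insert] at hgen'
  exact false_of_span_pair_eq_maximalIdeal_of_ringKrullDim hdim' hgen'

end Literature.AlgebraicGeometry.Resolution

end
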